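import Mathlib
import Summits.Ventures.Crystal3D.Theses.StickyWulffConstant
import Summits.Ventures.Crystal3D.Theorems.StickyWulffConstantTextureLiminfTexShadowDefs
import HarnessLib

/-!
# Line `TexShadow` for the crux `TextureLiminf` (stmt-Ventures-19483) — ATOMISTIC / TEXTURE VOCABULARY file (v6.2)

HONEST FRAMING. Part of the venture `Summits/Ventures/Crystal3D` (cell `crystal3d-full`), route
`route-Ventures-StickyWulffConstant`, crux `TextureLiminf` (stmt-Ventures-19483).  This file carries, VERBATIM
(def bodies byte-identical modulo whitespace), the part of the vocabulary of the planner's REGISTERED skeleton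
`HOME/cf-p1/route/lines/tex/TexShadow.lean` (v6.2, planner crystal3d-full-p1 gen 20; §1 «structured vocabulary,
unchanged since v2» and the v6.2 saturation definitions) that the stubs `stub_unsaturate` / `stub_textureBuild`
and the composition mention: `e₃`, `fccRef`, `phiB`, `SharedAxis`, `CoAx`, `iface`, `wulffOf`, `wallBody`,
`IsTexture`, `energy`, `vol`, `ShadowTheorem`, `touchCount`, `IsSaturated`, `ShadowTheoremSat` — so that these
stubs can be proved BY NAME in `Theorems/` files against exactly these names, and so that the T line has ONE
vocabulary module (cf-p1 g21, INBOX 2026-08-27T18:45:48Z).  It imports the continuum definitions file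
`…TexShadowDefs.lean` (`E3`, `perK`, `per`, …) as that file prescribes.  The v6 wall / certificate vocabulary
(`stacking`, `cube`, `bilayer`, `laySlab`, `perKIn`, `brokenNearIn`, `cyl`, `innerBonds`, `BarlowResolution`,
`BarlowAdhesionR`, `BilayerWall`, `BarlowFreeCertificate`) is deliberately NOT here (still being re-typed:
ROUTE.md §77/§78).  Definitions only; nothing is proved or claimed here.
WHAT THIS IS NOT: any statement about the stubs; rung F-C1 not moved.
-/

open scoped BigOperators InnerProductSpace ENNReal Pointwise
open MeasureTheory Filter Finset

namespace Summit.Ventures.Crystal3D.Cruxes.TextureLiminf.TexShadow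

open Summit.Ventures.Crystal3D
open Literature.MathematicalPhysics.StatisticalMechanics (fccStacking barlowStacking IsHaggSeq
  fieldDivergence HasFinitePerimeter perimeter contactDeficiency orderedContacts)

/-! ## §1 Vocabulary of the line (verbatim from `TexShadow.lean` v6.2) -/

/-- the stacking axis of the reference frame -/
noncomputable def e₃ : E3 := EuclideanSpace.single (2 : Fin 3) (1 : ℝ)

/-- reference fcc (Barlow frame, nearest-neighbour distance 1, `0 ∈ fccRef`) -/
noncomputable def fccRef : Set E3 := fccStacking 1 (Real.sqrt (2 / 3))

/-- fcc broken-bond surface tension in the Barlow frame (`= h_W`, `|W| = 32`). -/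
noncomputable def phiB (ν : E3) : ℝ :=
  Real.sqrt 2 / 4 * ∑ᶠ w ∈ {w ∈ fccRef | ‖w‖ = 1}, |⟪w, ν⟫_ℝ|

/-- `m` is a shared stacking axis of the two orientations (the `L e₃` of a common Barlow frame). -/
def SharedAxis (m : E3) (A B : E3 ≃ₗᵢ[ℝ] E3) : Prop :=
  ∃ (L : E3 ≃ₗᵢ[ℝ] E3) (s₁ s₂ : E3) (σ σ' : ℤ → ℤ), IsHaggSeq σ ∧ IsHaggSeq σ' ∧ L e₃ = m ∧
    A '' fccRef ⊆ (fun p => L p + s₁) '' barlowStacking 1 (Real.sqrt (2 / 3)) σ ∧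
    B '' fccRef ⊆ (fun p => L p + s₂) '' barlowStacking 1 (Real.sqrt (2 / 3)) σ'

/-- lattice-theoretic co-axiality of two fcc orientations: some shared stacking axis. -/
def CoAx (A B : E3 ≃ₗᵢ[ℝ] E3) : Prop := ∃ m, SharedAxis m A B

/-- `K`-weighted interface measure of two disjoint finite-perimeter sets. -/
noncomputable def iface (K A B : Set E3) : ℝ := (per K A + per K B - per K (A ∪ B)) / 2

/-- Wulff body of the grain with frame `A`. -/
def wulffOf (A : E3 ≃ₗᵢ[ℝ] E3) : Set E3 := {y | ∀ ν : E3, ⟪y, ν⟫_ℝ ≤ phiB (A.symm ν)}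

/-- wall body: unit ball (`m = 0`) or the unit disc `⊥ m` (`‖m‖ = 1`). -/
def wallBody (m : E3) : Set E3 := {y | ‖y‖ ≤ 1 ∧ ⟪y, m⟫_ℝ = 0}

/-- admissible finite fcc texture with wall data `(c, m)` obeying the three-regime law `(c₀, c₁)`. -/
def IsTexture (c₀ c₁ : ℝ) (n : ℕ) (G : Fin n → Set E3) (A : Fin n → (E3 ≃ₗᵢ[ℝ] E3))
    (c : Fin n → Fin n → ℝ) (m : Fin n → Fin n → E3) : Prop :=
  (∀ f, HasFinitePerimeter (G f) ∧ volume (G f) < ⊤) ∧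
  (∀ f g, f ≠ g → Disjoint (G f) (G g)) ∧
  (∀ f g, f ≠ g → 0 ≤ c f g) ∧
  (∀ f g, f ≠ g → ¬ CoAx (A f) (A g) → m f g = 0 ∧ c₀ ≤ c f g) ∧
  (∀ f g, f ≠ g → CoAx (A f) (A g) → A f '' fccRef ≠ A g '' fccRef →
      SharedAxis (m f g) (A f) (A g) ∧ c₁ ≤ c f g)

/-- the sharp-interface energy of a finite texture (free surface + walls). -/
noncomputable def energy (n : ℕ) (G : Fin n → Set E3) (A : Fin n → (E3 ≃ₗᵢ[ℝ] E3))
    (c : Fin n → Fin n → ℝ) (m : Fin n → Fin n → E3) : ℝ :=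
  ∑ f, per (wulffOf (A f)) (G f)
    - ∑ f, ∑ g, (if f = g then 0 else iface (wulffOf (A f)) (G f) (G g))
    + ∑ f, ∑ g, (if f = g then 0 else c f g / 2 * iface (wallBody (m f g)) (G f) (G g))

/-- total volume of the texture -/
noncomputable def vol (n : ℕ) (G : Fin n → Set E3) : ℝ := (volume (⋃ f, G f)).toReal

/-- **The shadow theorem** (single configuration, finite `N`). -/
def ShadowTheorem : Prop :=
  Summit.Ventures.Crystal3D.Theses.StickyWulffConstant.GenericWallFloor →
  Summit.Ventures.Crystal3D.Theses.StickyWulffConstant.CoaxialWallLaw →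
  Summit.Ventures.Crystal3D.Theses.StickyWulffConstant.NoReconstructionGain →
  Summit.Ventures.Crystal3D.Theses.StickyWulffConstant.StackingLiminf →
  ∀ K δ θ : ℝ, 0 < δ → 0 < θ → ∃ N₀ : ℕ, ∀ N : ℕ, N₀ ≤ N → ∀ x : Fin N → E3, IsUnitPacking x →
    6 * (N : ℝ) - (numContacts x : ℝ) ≤ K * (N : ℝ) ^ ((2 : ℝ) / 3) →
    ∃ (n : ℕ) (G : Fin n → Set E3) (A : Fin n → (E3 ≃ₗᵢ[ℝ] E3)) (c : Fin n → Fin n → ℝ)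
      (m : Fin n → Fin n → E3), IsTexture 1 (1 / 2) n G A c m ∧ 1 - δ ≤ Real.sqrt 2 * vol n G ∧
      energy n G A c m ≤ (6 * (N : ℝ) - (numContacts x : ℝ)) / (N : ℝ) ^ ((2 : ℝ) / 3) + θ

/-- number of balls of `x` touching the point `y` (distance exactly `1`); v6.2. -/
noncomputable def touchCount {N : ℕ} (x : Fin N → E3) (y : E3) : ℕ :=
  (Finset.univ.filter fun i => dist y (x i) = 1).card

/-- **6|6-saturated** cluster (v6.2, ROUTE.md §73.1). -/
def IsSaturated {N : ℕ} (x : Fin N → E3) : Prop :=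
  (∀ i, 6 ≤ coordination x i) ∧ ∀ y : E3, (∀ i, 1 ≤ dist y (x i)) → touchCount x y ≤ 6

/-- **The shadow theorem for saturated clusters** (v6.2). -/
def ShadowTheoremSat : Prop :=
  Summit.Ventures.Crystal3D.Theses.StickyWulffConstant.GenericWallFloor →
  Summit.Ventures.Crystal3D.Theses.StickyWulffConstant.CoaxialWallLaw →
  Summit.Ventures.Crystal3D.Theses.StickyWulffConstant.NoReconstructionGain →
  Summit.Ventures.Crystal3D.Theses.StickyWulffConstant.StackingLiminf →
  ∀ K δ θ : ℝ, 0 < δ → 0 < θ → ∃ N₀ : ℕ, ∀ N : ℕ, N₀ ≤ N → ∀ x : Fin N → E3, IsUnitPacking x →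
    IsSaturated x →
    6 * (N : ℝ) - (numContacts x : ℝ) ≤ K * (N : ℝ) ^ ((2 : ℝ) / 3) →
    ∃ (n : ℕ) (G : Fin n → Set E3) (A : Fin n → (E3 ≃ₗᵢ[ℝ] E3)) (c : Fin n → Fin n → ℝ)
      (m : Fin n → Fin n → E3), IsTexture 1 (1 / 2) n G A c m ∧ 1 - δ ≤ Real.sqrt 2 * vol n G ∧
      energy n G A c m ≤ (6 * (N : ℝ) - (numContacts x : ℝ)) / (N : ℝ) ^ ((2 : ℝ) / 3) + θ

end Summit.Ventures.Crystal3D.Cruxes.TextureLiminf.TexShadow
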